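/-
rh-split cell (screw), width seat 2 on line L22 (route-RiemannHypothesis-ScrewQuarticNodes, desk
rh-idea-9), 2026-08-27.  Pure-logic assembly of a DOOR ∧ DECLARED-RESIDUAL splitting: the residual
`QuarticNodePositivity` is RH-equivalent by declaration and stays OPEN — RH is not proved by this;
nothing here bears on the truth of RH.
-/
import Summits.RiemannHypothesis.RiemannHypothesis.Theses.ScrewQuarticNodes
import HarnessLib

/-!
# Route ScrewQuarticNodes (L22 «SPARSE-NODE SCREW DOOR») — `Assembly` (item stmt-RiemannHypothesis-22172)

`SparseNodeDoor → QuarticNodesDense → QuarticNodePositivity → RiemannHypothesis` is pure logic: apply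
the door with `K = 100` to the quartic node set `N = {4·log j : j ≥ 1}`; `QuarticNodesDense` is the
density hypothesis of the door for that `N`, and `QuarticNodePositivity` gives the node bounds
`-100 ≤ 0 ≤ Ψ(4 log j)`.  This is the planner's kernel-checked deciding theorem
`Theses.ScrewQuarticNodes.closes` (rh-idea-9 g0, glueB.lean), restated as the route decl `Assembly`.
CONDITIONAL bookkeeping: the door `SparseNodeDoor` is PROVED (stmt-22169,
`Theorems.ScrewQuarticNodesSparseNodeDoor.sparseNodeDoor_proof`), the residual `QuarticNodePositivity`
(stmt-22170) is RH-equivalent by declaration and is nobody's proving target — RH is not proved by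
this; nothing here bears on the truth of RH.
-/

-- D-0017: `Summit.RiemannHypothesis.RiemannHypothesis.…` duplicates the namespace BY DESIGN (single-problem summit).
set_option linter.dupNamespace false

namespace Summit.RiemannHypothesis.RiemannHypothesis.Theorems.ScrewQuarticNodes

open Summit.RiemannHypothesis.RiemannHypothesis.Theses.ScrewQuarticNodes in
/-- **`Assembly` (item stmt-RiemannHypothesis-22172) holds**: the door `SparseNodeDoor` at `K = 100`
on the quartic nodes `{4·log j : j ≥ 1}`, fed with `QuarticNodesDense` (density) and
`QuarticNodePositivity` (node bounds `Ψ(4 log j) ≥ 0 ≥ -100`), yields RH — exactly the route's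
deciding theorem `closes`.  Pure logic; RH is not proved by this (the residual stays open). -/
theorem assembly_proof :
    Summit.RiemannHypothesis.RiemannHypothesis.Theses.ScrewQuarticNodes.Assembly := by
  intro hA hN hR
  exact closes hA hN hR

end Summit.RiemannHypothesis.RiemannHypothesis.Theorems.ScrewQuarticNodes
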